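import Literature.Computability.MetaComplexity.CMMSA
import Mathlib.Data.List.Sections
import HarnessLib

/-!
# Self-improvement (squaring) of constant-gap CMMSA at bounded degree

Topic `Computability/Complexity`. At soundness `ε = 1` the promise problem
`gapCMMSA (fun _ => g) (fun _ => 1) Δ` of `CMMSA.lean` (Hirahara 2022, Def. 5.1) is the
*collective* Minimum Monotone Satisfying Assignment problem with gap `g`: yes — some assignment of
weight `≤ s` satisfies every formula of the collection; no — every assignment of weight `≤ g · s`
falsifies some formula. The Minimum Monotone Satisfying Assignment problem is *self-improvable*
(Alekhnovich–Buss–Moran–Pitassi 2001, §2, Lemma 2, "self-improvement property": for the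
composition `φ₁ ∗ φ₂ = φ₁(φ₂(x_{1·}), …, φ₂(x_{k·}))` the minimum weight of a satisfying assignment
multiplies, `ρ(φ₁ ∗ φ₂) = ρ(φ₁) · ρ(φ₂)`, and `|φ₁ ∗ φ₂| ≤ |φ₁| · |φ₂|`; iterated a constant number of
times it raises any constant gap to any other, proof of Thm. 3 there): substituting for every
variable `xᵢ` of a monotone formula `F` a copy `F(x_{i,·})` of `F` on fresh variables squares the
minimum weight of a satisfying assignment, hence squares the gap. This file carries the substitution out on
COLLECTIONS OF SMALL DNFs, keeping the degree (the size of the individual formulas) bounded: with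
`F = ⋀ⱼ φⱼ` the substituted formula `φⱼ[xᵢ := ⋀_{j'} φ_{j'}(x_{i,·})]` is, by the CNF/DNF
distributive law, the conjunction over all *sections* `c = ((i_t, φ'_t))_{t ∈ φⱼ}` (one variable
`i_t ∈ t` and one formula `φ'_t` of the collection per term `t` of `φⱼ`) of the small DNFs
`ψ_{j,c} = ⋁_{t ∈ φⱼ} φ'_t(x_{i_t,·})`, each with at most `(degree)²` literals; for constant degree
there are polynomially many of them.

* `CMMSASquare.square K I` — the squared instance: `n²` variables `(i, i') ↦ i · n + i'`, the
  formulas `ψ_{j,c}` (sections truncated at depth `K`, `sectionsK`, which is all of them on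
  instances of degree `≤ K`), product weights `w(i) · w(i')`, threshold `s²`;
* `CMMSASquare.wellFormed_square`, `degree_square_le` (`≤ K · K`);
* `CMMSASquare.square_mem_yesSet` — yes-instances of degree `≤ K` go to yes-instances of degree
  `≤ K · K` (the tensor square `a ⊗ a` of a satisfying assignment);
* `CMMSASquare.square_mem_noSet` — no-instances with gap `g ≥ 1` (soundness `1`, degree `≤ K`) go
  to no-instances with gap `g²` (the rows of a cheap all-satisfying assignment that satisfy
  everything are expensive, so the set of such rows is a cheap assignment of the original instance,
  hence falsifies some `φⱼ`; choosing a falsified inner formula per term gives a falsified `ψ_{j,c}`).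

The polynomial-time implementation and the resulting Karp reduction
`gapCMMSA g 1 K ≤ₚ gapCMMSA g² 1 K²` are in `CMMSASquaringMachine.lean`.

## References

* M. Alekhnovich, S. Buss, S. Moran, T. Pitassi, *Minimum propositional proof length is NP-hard to
  linearly approximate*, J. Symbolic Logic 66 (2001) 171–191, §2 (Monotone Minimum Satisfying
  Assignment; Lemma 2, the self-improvement property; Thm. 3, its iteration) [AlekhnovichEtAl2001].
* I. Dinur, S. Safra, *On the hardness of approximating label-cover*, Inform. Process. Lett. 89
  (2004) 247–254 (MMSA; the reduction Hirahara's Thm. 5.2 adapts) [DinurSafra2004].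
* S. Hirahara, *NP-hardness of learning programs and partial MCSP*, ECCC TR22-119 (FOCS 2022),
  Def. 5.1 (CMMSA, degree) [Hirahara2022PartialMCSP].
-/

namespace Literature.Computability.Complexity

open MetaComplexity

namespace CMMSASquare

/-! ### Sections of a list of lists, truncated at a fixed depth -/

/-- The sections of the first `K` lists of `L` (all sections when `|L| ≤ K`): one item from each
list. Truncation at a constant depth keeps the enumeration polynomial on every input.
[folklore] -/
def sectionsK {α : Type} : ℕ → List (List α) → List (List α)
  | 0, _ => [[]]
  | _ + 1, [] => [[]]
  | K + 1, l :: L => (sectionsK K L).flatMap fun s => l.map fun a => a :: s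

/-- `sectionsK 0 L = [[]]`. [folklore] -/
@[simp] theorem sectionsK_zero {α : Type} (L : List (List α)) : sectionsK 0 L = [[]] := by
  cases L <;> rfl

/-- `sectionsK (K+1) [] = [[]]`. [folklore] -/
@[simp] theorem sectionsK_succ_nil {α : Type} (K : ℕ) : sectionsK (K + 1) ([] : List (List α)) = [[]] := rfl

/-- `sectionsK (K+1) (l :: L)`. [folklore] -/
@[simp] theorem sectionsK_succ_cons {α : Type} (K : ℕ) (l : List α) (L : List (List α)) :
    sectionsK (K + 1) (l :: L) = (sectionsK K L).flatMap fun s => l.map fun a => a :: s := rfl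

/-- Below the truncation depth, `sectionsK` lists all sections. [folklore] -/
theorem sectionsK_eq_sections {α : Type} :
    ∀ (K : ℕ) (L : List (List α)), L.length ≤ K → sectionsK K L = L.sections
  | 0, [], _ => rfl
  | 0, _ :: _, h => absurd h (by simp)
  | _ + 1, [], _ => rfl
  | K + 1, l :: L, h => by
    rw [sectionsK_succ_cons, List.sections, sectionsK_eq_sections K L (by simpa using h)]

/-- Every item of a truncated section comes from one of the lists. [folklore] -/
theorem exists_mem_of_mem_sectionsK {α : Type} :
    ∀ (K : ℕ) (L : List (List α)) (c : List α), c ∈ sectionsK K L → ∀ a ∈ c, ∃ l ∈ L, a ∈ l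
  | 0, L, c, hc, a, ha => by simp at hc; subst hc; simp at ha
  | K + 1, [], c, hc, a, ha => by simp at hc; subst hc; simp at ha
  | K + 1, l :: L, c, hc, a, ha => by
    rw [sectionsK_succ_cons, List.mem_flatMap] at hc
    obtain ⟨s, hs, hc⟩ := hc
    rw [List.mem_map] at hc
    obtain ⟨b, hb, rfl⟩ := hc
    rcases List.mem_cons.1 ha with rfl | ha'
    · exact ⟨l, List.mem_cons_self, hb⟩
    · obtain ⟨l', hl', hal'⟩ := exists_mem_of_mem_sectionsK K L s hs a ha'
      exact ⟨l', List.mem_cons_of_mem _ hl', hal'⟩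

/-- A truncated section has at most `K` items. [folklore] -/
theorem length_le_of_mem_sectionsK {α : Type} :
    ∀ (K : ℕ) (L : List (List α)) (c : List α), c ∈ sectionsK K L → c.length ≤ K
  | 0, L, c, hc => by simp at hc; subst hc; simp
  | K + 1, [], c, hc => by simp at hc; subst hc; simp
  | K + 1, l :: L, c, hc => by
    rw [sectionsK_succ_cons, List.mem_flatMap] at hc
    obtain ⟨s, hs, hc⟩ := hc
    rw [List.mem_map] at hc
    obtain ⟨b, -, rfl⟩ := hc
    have := length_le_of_mem_sectionsK K L s hs
    simp only [List.length_cons]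
    omega

/-- Choice along a list: if every list of `L` contains an item with property `P`, some section of
`L` consists of such items. [folklore] -/
theorem exists_forall₂_of_forall_exists {α : Type} {P : α → Prop} :
    ∀ L : List (List α), (∀ l ∈ L, ∃ a ∈ l, P a) →
      ∃ c : List α, List.Forall₂ (· ∈ ·) c L ∧ ∀ a ∈ c, P a
  | [], _ => ⟨[], List.Forall₂.nil, fun a ha => by simp at ha⟩
  | l :: L, h => by
    obtain ⟨a, ha, hPa⟩ := h l List.mem_cons_self
    obtain ⟨c, hc, hPc⟩ := exists_forall₂_of_forall_exists L fun l' hl' => h l' (List.mem_cons_of_mem _ hl')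
    refine ⟨a :: c, List.Forall₂.cons ha hc, fun b hb => ?_⟩
    rcases List.mem_cons.1 hb with rfl | hb'
    · exact hPa
    · exact hPc b hb'

/-- In a `Forall₂`-related pair of lists every item of the right list has a partner on the left.
[folklore] -/
theorem exists_left_of_forall₂ {α β : Type} {R : α → β → Prop} {c : List α} {L : List β}
    (h : List.Forall₂ R c L) : ∀ l ∈ L, ∃ a ∈ c, R a l := by
  induction h with
  | nil => intro l hl; simp at hl
  | cons hab _ ih =>
    intro l hl
    rcases List.mem_cons.1 hl with rfl | hl'
    · exact ⟨_, List.mem_cons_self, hab⟩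
    · obtain ⟨a, ha, hR⟩ := ih l hl'
      exact ⟨a, List.mem_cons_of_mem _ ha, hR⟩

/-- In a `Forall₂`-related pair of lists every item of the left list has a partner on the right.
[folklore] -/
theorem exists_right_of_forall₂ {α β : Type} {R : α → β → Prop} {c : List α} {L : List β}
    (h : List.Forall₂ R c L) : ∀ a ∈ c, ∃ l ∈ L, R a l := by
  induction h with
  | nil => intro a ha; simp at ha
  | cons hab _ ih =>
    intro a ha
    rcases List.mem_cons.1 ha with rfl | ha'
    · exact ⟨_, List.mem_cons_self, hab⟩
    · obtain ⟨l, hl, hR⟩ := ih a ha'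
      exact ⟨l, List.mem_cons_of_mem _ hl, hR⟩

/-! ### Monotone DNF bookkeeping -/

/-- The non-trivial formulas of a collection: those without the empty term (a DNF containing the
empty term is identically true and can be dropped from an "all formulas satisfied" collection).
[folklore] -/
def nontriv (Φ : List MonotoneDNF) : List MonotoneDNF :=
  Φ.filter fun φ => !φ.any List.isEmpty

/-- Membership in `nontriv`. [folklore] -/
theorem mem_nontriv {Φ : List MonotoneDNF} {φ : MonotoneDNF} :
    φ ∈ nontriv Φ ↔ φ ∈ Φ ∧ ∀ t ∈ φ, t ≠ [] := by
  unfold nontriv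
  rw [List.mem_filter]
  refine and_congr Iff.rfl ?_
  simp [List.isEmpty_iff]

/-- `nontriv Φ ⊆ Φ`. [folklore] -/
theorem mem_of_mem_nontriv {Φ : List MonotoneDNF} {φ : MonotoneDNF} (h : φ ∈ nontriv Φ) : φ ∈ Φ :=
  (mem_nontriv.1 h).1

/-- A formula of the collection outside `nontriv` is identically true. [folklore] -/
theorem eval_eq_true_of_not_mem_nontriv {Φ : List MonotoneDNF} {φ : MonotoneDNF} (hφ : φ ∈ Φ)
    (h : φ ∉ nontriv Φ) (a : ℕ → Bool) : φ.eval a = true := by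
  rw [mem_nontriv, not_and] at h
  have h' := h hφ
  push Not at h'
  obtain ⟨t, ht, rfl⟩ := h'
  exact MonotoneDNF.eval_eq_true_of_nil_mem ht a

/-- A falsified formula of the collection is non-trivial. [folklore] -/
theorem mem_nontriv_of_eval_eq_false {Φ : List MonotoneDNF} {φ : MonotoneDNF} (hφ : φ ∈ Φ)
    {a : ℕ → Bool} (h : φ.eval a = false) : φ ∈ nontriv Φ := by
  by_contra hn
  rw [eval_eq_true_of_not_mem_nontriv hφ hn a] at h
  exact Bool.noConfusion h

/-- A DNF without the empty term has at most `|φ|` terms. [folklore] -/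
theorem length_le_numLiterals {φ : MonotoneDNF} (h : ∀ t ∈ φ, t ≠ []) : φ.length ≤ φ.numLiterals := by
  induction φ with
  | nil => simp
  | cons t φ ih =>
    rw [MonotoneDNF.numLiterals_cons, List.length_cons]
    have ht : t ≠ [] := h t List.mem_cons_self
    have h1 : 1 ≤ t.length := by
      cases t with
      | nil => exact absurd rfl ht
      | cons _ _ => simp
    have := ih fun t' ht' => h t' (List.mem_cons_of_mem _ ht')
    omega

/-- The literal count is additive under concatenation of term lists. [folklore] -/
theorem numLiterals_append (φ ψ : MonotoneDNF) : MonotoneDNF.numLiterals (φ ++ ψ) = φ.numLiterals + ψ.numLiterals := by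
  simp [MonotoneDNF.numLiterals]

/-- The value of a formula over `[n]` only depends on the assignment below `n`. [folklore] -/
theorem eval_congr_of_isOver {n : ℕ} {φ : MonotoneDNF} (hφ : φ.IsOver n) {a b : ℕ → Bool}
    (hab : ∀ i < n, a i = b i) : φ.eval a = φ.eval b := by
  rw [Bool.eq_iff_iff, MonotoneDNF.eval_eq_true_iff, MonotoneDNF.eval_eq_true_iff]
  constructor
  · rintro ⟨t, ht, hta⟩
    exact ⟨t, ht, fun i hi => by rw [← hab i (hφ t ht i hi)]; exact hta i hi⟩
  · rintro ⟨t, ht, htb⟩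
    exact ⟨t, ht, fun i hi => by rw [hab i (hφ t ht i hi)]; exact htb i hi⟩

/-- A formula is falsified iff every term contains a false variable. [folklore] -/
theorem eval_eq_false_iff (φ : MonotoneDNF) (a : ℕ → Bool) :
    φ.eval a = false ↔ ∀ t ∈ φ, ∃ i ∈ t, a i = false := by
  rw [← Bool.not_eq_true, MonotoneDNF.eval_eq_true_iff]
  push Not
  simp only [Bool.not_eq_true]

/-! ### The construction -/

/-- The term `t` of an inner formula relocated to row `i`: `i' ↦ i · n + i'`. [cite: AlekhnovichEtAl2001, §2, Lemma 2 (the composition φ₁ ∗ φ₂ = φ₁(φ₂(x_{1·}), …, φ₂(x_{k·})))] -/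
def rowTerm (n i : ℕ) (t : List ℕ) : List ℕ :=
  t.map fun i' => i * n + i'

/-- The inner formula `φ(x_{i,·})` on row `i`. [cite: AlekhnovichEtAl2001, §2, Lemma 2] -/
def rowDNF (n i : ℕ) (φ : MonotoneDNF) : MonotoneDNF :=
  φ.map (rowTerm n i)

/-- The formula `ψ_c = ⋁_{(i, φ') ∈ c} φ'(x_{i,·})` of a section `c`. [cite: AlekhnovichEtAl2001, §2, Lemma 2 (self-improvement), distributed into small formulas] -/
def secFormula (n : ℕ) (c : List (ℕ × MonotoneDNF)) : MonotoneDNF :=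
  c.flatMap fun q => rowDNF n q.1 q.2

/-- The choice lists of a formula: for each term `t`, the pairs `(i, φ')` with `i ∈ t` and `φ'` in
the collection. [folklore] -/
def choices (Φ : List MonotoneDNF) (φ : MonotoneDNF) : List (List (ℕ × MonotoneDNF)) :=
  φ.map fun t => t ×ˢ Φ

/-- The formulas of the squared instance: `ψ_{j,c}` for `φⱼ` non-trivial and `c` a (depth-`K`)
section of `choices`. [cite: AlekhnovichEtAl2001, §2, Lemma 2 (self-improvement)] -/
def sqFormulas (K n : ℕ) (Φ : List MonotoneDNF) : List MonotoneDNF :=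
  (nontriv Φ).flatMap fun φ => (sectionsK K (choices (nontriv Φ) φ)).map (secFormula n)

/-- The product weights `w'(i · n + i') = w(i) · w(i')`, row by row. [cite: AlekhnovichEtAl2001, §2, Lemma 2] -/
def sqWeight (w : List ℕ) : List ℕ :=
  (w.map fun a => w.map fun b => a * b).flatten

/-- **The squared CMMSA instance** (variables `[n²]`, formulas `ψ_{j,c}`, product weights,
threshold `s²`). [cite: AlekhnovichEtAl2001, §2, Lemma 2 (self-improvement)] -/
def square (K : ℕ) (I : CMMSAInstance) : CMMSAInstance :=
  ⟨I.numVars * I.numVars, sqFormulas K I.numVars I.formulas, sqWeight I.weight,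
    I.threshold * I.threshold⟩

/-- The row `i` of an assignment of the squared variables. [folklore] -/
def row (n : ℕ) (B : ℕ → Bool) (i : ℕ) : ℕ → Bool :=
  fun i' => B (i * n + i')

/-- The tensor square `(a ⊗ a)(i · n + i') = a(i) ∧ a(i')` of an assignment. [cite: AlekhnovichEtAl2001, §2, Lemma 2] -/
def tensor (n : ℕ) (a : ℕ → Bool) : ℕ → Bool :=
  fun v => a (v / n) && a (v % n)

/-! ### Elementary identities -/

/-- `numVars (square K I) = n²`. [folklore] -/
@[simp] theorem square_numVars (K : ℕ) (I : CMMSAInstance) : (square K I).numVars = I.numVars * I.numVars := rfl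

/-- `formulas (square K I)`. [folklore] -/
@[simp] theorem square_formulas (K : ℕ) (I : CMMSAInstance) :
    (square K I).formulas = sqFormulas K I.numVars I.formulas := rfl

/-- `weight (square K I)`. [folklore] -/
@[simp] theorem square_weight (K : ℕ) (I : CMMSAInstance) : (square K I).weight = sqWeight I.weight := rfl

/-- `threshold (square K I) = s²`. [folklore] -/
@[simp] theorem square_threshold (K : ℕ) (I : CMMSAInstance) :
    (square K I).threshold = I.threshold * I.threshold := rfl

/-- `tensor` on the variable `(i, i')`. [folklore] -/
theorem tensor_apply {n : ℕ} (a : ℕ → Bool) (i : ℕ) {i' : ℕ} (hi' : i' < n) :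
    tensor n a (i * n + i') = (a i && a i') := by
  have hn : 0 < n := by omega
  unfold tensor
  rw [mul_comm, Nat.mul_add_div hn, Nat.mul_add_mod, Nat.div_eq_of_lt hi', Nat.mod_eq_of_lt hi', add_zero]

/-- The row `i` of `tensor n a` agrees with `a` below `n` when `a i`, and is `false` otherwise. [folklore] -/
theorem row_tensor {n : ℕ} (a : ℕ → Bool) (i : ℕ) {i' : ℕ} (hi' : i' < n) :
    row n (tensor n a) i i' = (a i && a i') :=
  tensor_apply a i hi'

/-- Membership in the formulas of the squared instance. [folklore] -/
theorem mem_sqFormulas {K n : ℕ} {Φ : List MonotoneDNF} {ψ : MonotoneDNF} :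
    ψ ∈ sqFormulas K n Φ ↔ ∃ φ ∈ nontriv Φ, ∃ c ∈ sectionsK K (choices (nontriv Φ) φ), secFormula n c = ψ := by
  unfold sqFormulas
  simp only [List.mem_flatMap, List.mem_map]

/-- The value of the formula of a section: some chosen inner formula holds on its row.
[cite: AlekhnovichEtAl2001, §2, Lemma 2] -/
theorem eval_secFormula_eq_true_iff (n : ℕ) (c : List (ℕ × MonotoneDNF)) (B : ℕ → Bool) :
    (secFormula n c).eval B = true ↔ ∃ q ∈ c, q.2.eval (row n B q.1) = true := by
  rw [MonotoneDNF.eval_eq_true_iff]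
  constructor
  · rintro ⟨T, hT, hTB⟩
    unfold secFormula at hT
    rw [List.mem_flatMap] at hT
    obtain ⟨q, hq, hT⟩ := hT
    unfold rowDNF at hT
    rw [List.mem_map] at hT
    obtain ⟨t', ht', rfl⟩ := hT
    refine ⟨q, hq, (MonotoneDNF.eval_eq_true_iff _ _).2 ⟨t', ht', fun i' hi' => ?_⟩⟩
    exact hTB (q.1 * n + i') (List.mem_map.2 ⟨i', hi', rfl⟩)
  · rintro ⟨q, hq, hqB⟩
    obtain ⟨t', ht', ht'B⟩ := (MonotoneDNF.eval_eq_true_iff _ _).1 hqB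
    refine ⟨rowTerm n q.1 t', ?_, fun v hv => ?_⟩
    · unfold secFormula rowDNF
      rw [List.mem_flatMap]
      exact ⟨q, hq, List.mem_map.2 ⟨t', ht', rfl⟩⟩
    · unfold rowTerm at hv
      obtain ⟨i', hi', rfl⟩ := List.mem_map.1 hv
      exact ht'B i' hi'

/-- The literal count of the formula of a section is the sum of those of the chosen inner
formulas. [folklore] -/
theorem numLiterals_secFormula (n : ℕ) (c : List (ℕ × MonotoneDNF)) :
    (secFormula n c).numLiterals = (c.map fun q => q.2.numLiterals).sum := by
  induction c with
  | nil => rfl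
  | cons q c ih =>
    unfold secFormula at ih ⊢
    rw [List.flatMap_cons, numLiterals_append, ih, List.map_cons, List.sum_cons]
    congr 1
    simp [rowDNF, rowTerm, MonotoneDNF.numLiterals, Function.comp_def]

/-! ### Weights -/

/-- `|sqWeight w| = |w|²`. [folklore] -/
theorem length_sqWeight (w : List ℕ) : (sqWeight w).length = w.length * w.length := by
  unfold sqWeight
  rw [List.length_flatten, List.map_map]
  have : (w.map (List.length ∘ fun a => w.map fun b => a * b)) = List.replicate w.length w.length := by
    rw [List.eq_replicate_iff]
    refine ⟨List.length_map _, fun b hb => ?_⟩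
    obtain ⟨a, -, rfl⟩ := List.mem_map.1 hb
    simp
  rw [this, List.sum_replicate, smul_eq_mul]

/-- Indexing a flattened list of rows of a common length. [folklore] -/
theorem getD_flatten_of_length_eq {n : ℕ} {d : ℕ} :
    ∀ (L : List (List ℕ)), (∀ l ∈ L, l.length = n) → ∀ (i i' : ℕ), i' < n →
      L.flatten.getD (i * n + i') d = (L.getD i []).getD i' d
  | [], _, i, i', _ => by simp
  | l :: L, hL, 0, i', hi' => by
    have hl : l.length = n := hL l List.mem_cons_self
    rw [List.flatten_cons, zero_mul, zero_add, List.getD_append _ _ _ _ (by omega)]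
    simp
  | l :: L, hL, i + 1, i', hi' => by
    have hl : l.length = n := hL l List.mem_cons_self
    rw [List.flatten_cons, List.getD_append_right _ _ _ _ (by rw [hl]; nlinarith),
      show (i + 1) * n + i' - l.length = i * n + i' by rw [hl]; ring_nf; omega]
    rw [getD_flatten_of_length_eq L (fun l' hl' => hL l' (List.mem_cons_of_mem _ hl')) i i' hi']
    simp

/-- **The product weights**: `w'(i · n + i') = w(i) · w(i')` for `i, i' < n = |w|`. [cite: AlekhnovichEtAl2001, §2, Lemma 2] -/
theorem getD_sqWeight (w : List ℕ) {i i' : ℕ} (hi : i < w.length) (hi' : i' < w.length) :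
    (sqWeight w).getD (i * w.length + i') 0 = w.getD i 0 * w.getD i' 0 := by
  unfold sqWeight
  rw [getD_flatten_of_length_eq _ (fun l hl => by
      obtain ⟨a, -, rfl⟩ := List.mem_map.1 hl
      simp) i i' hi']
  have h1 : (w.map fun a => w.map fun b => a * b).getD i [] = w.map fun b => w[i] * b := by
    rw [List.getD_eq_getElem _ _ (by simpa using hi), List.getElem_map]
  rw [h1, List.getD_eq_getElem _ _ (by simpa using hi'), List.getElem_map, List.getD_eq_getElem _ _ hi,
    List.getD_eq_getElem _ _ hi']

/-- Block decomposition of a sum over `range (n * n)`. [folklore] -/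
theorem sum_range_mul_eq (f : ℕ → ℕ) (n q : ℕ) :
    ∑ v ∈ Finset.range (n * q), f v = ∑ i ∈ Finset.range n, ∑ i' ∈ Finset.range q, f (i * q + i') := by
  induction n with
  | zero => simp
  | succ n ih => rw [Nat.succ_mul, Finset.sum_range_add, ih, Finset.sum_range_succ]

/-- **The weight of an assignment of the squared instance**, as a double sum (well-formed input).
[cite: AlekhnovichEtAl2001, §2, Lemma 2] -/
theorem weightOf_square {K : ℕ} {I : CMMSAInstance} (hw : I.weight.length = I.numVars) (B : ℕ → Bool) :
    (square K I).weightOf B = ∑ i ∈ Finset.range I.numVars, ∑ i' ∈ Finset.range I.numVars,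
      if B (i * I.numVars + i') then I.w i * I.w i' else 0 := by
  unfold CMMSAInstance.weightOf
  rw [square_numVars, sum_range_mul_eq]
  refine Finset.sum_congr rfl fun i hi => Finset.sum_congr rfl fun i' hi' => ?_
  have h : (square K I).w (i * I.numVars + i') = I.w i * I.w i' := by
    unfold CMMSAInstance.w
    rw [square_weight, ← hw]
    exact getD_sqWeight I.weight (by rw [hw]; exact Finset.mem_range.1 hi)
      (by rw [hw]; exact Finset.mem_range.1 hi')
  rw [h]

/-- **The weight of an assignment of the squared instance is `Σᵢ w(i) · w(row i)`.**
[cite: AlekhnovichEtAl2001, §2, Lemma 2] -/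
theorem weightOf_square_eq_sum_rows {K : ℕ} {I : CMMSAInstance} (hw : I.weight.length = I.numVars)
    (B : ℕ → Bool) :
    (square K I).weightOf B = ∑ i ∈ Finset.range I.numVars, I.w i * I.weightOf (row I.numVars B i) := by
  rw [weightOf_square hw]
  refine Finset.sum_congr rfl fun i _ => ?_
  unfold CMMSAInstance.weightOf row
  rw [Finset.mul_sum]
  refine Finset.sum_congr rfl fun i' _ => ?_
  split_ifs <;> simp

/-- **The weight of the tensor square is the square of the weight.** [cite: AlekhnovichEtAl2001, §2, Lemma 2 (ρ(φ₁ ∗ φ₂) = ρ(φ₁) · ρ(φ₂))] -/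
theorem weightOf_square_tensor {K : ℕ} {I : CMMSAInstance} (hw : I.weight.length = I.numVars)
    (a : ℕ → Bool) : (square K I).weightOf (tensor I.numVars a) = I.weightOf a * I.weightOf a := by
  rw [weightOf_square hw]
  unfold CMMSAInstance.weightOf
  rw [Finset.sum_mul_sum]
  refine Finset.sum_congr rfl fun i _ => Finset.sum_congr rfl fun i' hi' => ?_
  rw [tensor_apply a i (Finset.mem_range.1 hi')]
  cases a i <;> cases a i' <;> simp

/-! ### Well-formedness and degree -/

/-- Items of a section of `choices Φ φ` are pairs `(i, φ')` with `i` in a term of `φ` and `φ' ∈ Φ`.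
[folklore] -/
theorem mem_of_mem_section {K : ℕ} {Φ : List MonotoneDNF} {φ : MonotoneDNF}
    {c : List (ℕ × MonotoneDNF)} (hc : c ∈ sectionsK K (choices Φ φ)) {q : ℕ × MonotoneDNF}
    (hq : q ∈ c) : (∃ t ∈ φ, q.1 ∈ t) ∧ q.2 ∈ Φ := by
  obtain ⟨l, hl, hql⟩ := exists_mem_of_mem_sectionsK K _ c hc q hq
  unfold choices at hl
  obtain ⟨t, ht, rfl⟩ := List.mem_map.1 hl
  obtain ⟨q1, q2⟩ := q
  rw [List.mem_product] at hql
  exact ⟨⟨t, ht, hql.1⟩, hql.2⟩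

/-- **The squared instance of a well-formed instance is well-formed.** [folklore] -/
theorem wellFormed_square (K : ℕ) {I : CMMSAInstance} (h : I.WellFormed) : (square K I).WellFormed := by
  refine ⟨by rw [square_weight, length_sqWeight, h.1]; rfl, fun ψ hψ T hT v hv => ?_⟩
  rw [square_formulas, mem_sqFormulas] at hψ
  obtain ⟨φ, hφ, c, hc, rfl⟩ := hψ
  unfold secFormula at hT
  rw [List.mem_flatMap] at hT
  obtain ⟨q, hq, hT⟩ := hT
  unfold rowDNF at hT
  obtain ⟨t', ht', rfl⟩ := List.mem_map.1 hT
  unfold rowTerm at hv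
  obtain ⟨i', hi', rfl⟩ := List.mem_map.1 hv
  obtain ⟨⟨t, ht, hqt⟩, hq2⟩ := mem_of_mem_section hc hq
  have hi : q.1 < I.numVars := h.2 φ (mem_of_mem_nontriv hφ) t ht q.1 hqt
  have hi'n : i' < I.numVars := h.2 q.2 (mem_of_mem_nontriv hq2) t' ht' i' hi'
  rw [square_numVars]
  calc q.1 * I.numVars + i' < q.1 * I.numVars + I.numVars := by omega
    _ = (q.1 + 1) * I.numVars := by ring
    _ ≤ I.numVars * I.numVars := Nat.mul_le_mul_right _ hi

/-- **The degree at most squares**: `degree (square K I) ≤ K · K` when `degree I ≤ K`.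
[cite: AlekhnovichEtAl2001, §2, Lemma 2 (|φ₁ ∗ φ₂| ≤ |φ₁| · |φ₂|)] -/
theorem degree_square_le {K : ℕ} {I : CMMSAInstance} (hdeg : I.degree ≤ K) : (square K I).degree ≤ K * K := by
  rw [CMMSAInstance.degree_le_iff]
  intro ψ hψ
  rw [square_formulas, mem_sqFormulas] at hψ
  obtain ⟨φ, -, c, hc, rfl⟩ := hψ
  rw [numLiterals_secFormula]
  have hlen : c.length ≤ K := length_le_of_mem_sectionsK K _ c hc
  have hitem : ∀ x ∈ c.map (fun q => q.2.numLiterals), x ≤ K := by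
    intro x hx
    obtain ⟨q, hq, rfl⟩ := List.mem_map.1 hx
    exact (I.degree_le_iff K).1 hdeg q.2 (mem_of_mem_nontriv (mem_of_mem_section hc hq).2)
  calc (c.map fun q => q.2.numLiterals).sum ≤ (c.map fun q => q.2.numLiterals).length • K :=
        List.sum_le_card_nsmul _ _ hitem
    _ ≤ K * K := by rw [List.length_map, smul_eq_mul]; exact Nat.mul_le_mul_right _ hlen

/-- On instances of degree `≤ K` the truncated sections of `choices` are all the sections.
[folklore] -/
theorem sectionsK_choices_eq {K : ℕ} {I : CMMSAInstance} (hdeg : I.degree ≤ K) {φ : MonotoneDNF}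
    (hφ : φ ∈ nontriv I.formulas) :
    sectionsK K (choices (nontriv I.formulas) φ) = (choices (nontriv I.formulas) φ).sections := by
  refine sectionsK_eq_sections K _ ?_
  unfold choices
  rw [List.length_map]
  exact (length_le_numLiterals (mem_nontriv.1 hφ).2).trans
    ((I.degree_le_iff K).1 hdeg φ (mem_of_mem_nontriv hφ))

/-! ### Completeness: yes ↦ yes -/

/-- **Yes-instances of degree `≤ K` square to yes-instances of degree `≤ K²`** (the tensor square
of a cheap all-satisfying assignment is a cheap all-satisfying assignment).
[cite: AlekhnovichEtAl2001, §2, Lemma 2 (self-improvement)] -/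
theorem square_mem_yesSet {K : ℕ} {I : CMMSAInstance} (hI : I ∈ CMMSA.yesSet fun _ => K) :
    square K I ∈ CMMSA.yesSet fun _ => K * K := by
  obtain ⟨hwf, hdeg, a, ha, hall⟩ := hI
  refine ⟨wellFormed_square K hwf, degree_square_le hdeg, tensor I.numVars a, ?_, fun ψ hψ => ?_⟩
  · rw [weightOf_square_tensor hwf.1, square_threshold]
    exact Nat.mul_le_mul ha ha
  · rw [square_formulas, mem_sqFormulas] at hψ
    obtain ⟨φ, hφ, c, hc, rfl⟩ := hψ
    rw [sectionsK_choices_eq hdeg hφ, List.mem_sections] at hc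
    -- a term of `φ` satisfied by `a`
    obtain ⟨t, ht, hta⟩ := (MonotoneDNF.eval_eq_true_iff _ _).1 (hall φ (mem_of_mem_nontriv hφ))
    -- its partner in the section
    obtain ⟨q, hq, hqt⟩ := exists_left_of_forall₂ hc (t ×ˢ nontriv I.formulas)
      (by unfold choices; exact List.mem_map.2 ⟨t, ht, rfl⟩)
    obtain ⟨q1, q2⟩ := q
    rw [List.mem_product] at hqt
    rw [eval_secFormula_eq_true_iff]
    refine ⟨(q1, q2), hq, ?_⟩
    have hq2 : q2.eval a = true := hall q2 (mem_of_mem_nontriv hqt.2)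
    have hrow : q2.eval (row I.numVars (tensor I.numVars a) q1) = q2.eval a :=
      eval_congr_of_isOver (hwf.2 q2 (mem_of_mem_nontriv hqt.2)) fun i' hi' => by
        rw [row_tensor a q1 hi', hta q1 hqt.1, Bool.true_and]
    simpa [hrow] using hq2

/-! ### Soundness: no ↦ no -/

/-- `satCount < m` iff some formula of the collection is falsified. [folklore] -/
theorem satCount_lt_numFormulas_iff (I : CMMSAInstance) (a : ℕ → Bool) :
    I.satCount a < I.numFormulas ↔ ∃ φ ∈ I.formulas, φ.eval a = false := by
  have hle := I.satCount_le_numFormulas a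
  rw [lt_iff_le_and_ne, and_iff_right hle, Ne, I.satCount_eq_numFormulas_iff]
  push Not
  simp only [Bool.not_eq_true]

/-- The soundness-`1` no-condition in terms of falsified formulas. [folklore] -/
theorem real_satCount_lt_iff (I : CMMSAInstance) (a : ℕ → Bool) :
    (I.satCount a : ℝ) < 1 * I.numFormulas ↔ ∃ φ ∈ I.formulas, φ.eval a = false := by
  rw [one_mul, Nat.cast_lt, satCount_lt_numFormulas_iff]

/-- **No-instances (gap `g ≥ 1`, soundness `1`, degree `≤ K`) square to no-instances with gap `g²`**.
If an assignment `B` of weight `≤ g² s²` satisfied every `ψ_{j,c}`, let `Y` be the set of rows `i`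
on which every formula of the collection holds; such rows cost `> g · s` each (no-promise), so
`w(Y) · g s < w'(B) ≤ g² s²` forces `w(Y) ≤ g s`, and the no-promise falsifies some `φⱼ` on `Y`:
every term `t` of `φⱼ` has a variable `i_t ∉ Y`, i.e. a formula `φ'_t` false on row `i_t`, and then
`ψ_{j,(i_t, φ'_t)_t}` is false under `B`. [cite: AlekhnovichEtAl2001, §2, Lemma 2 (self-improvement)] -/
theorem square_mem_noSet {K : ℕ} {g : ℝ} (hg : 1 ≤ g) {I : CMMSAInstance}
    (hI : I ∈ CMMSA.noSet (fun _ => g) (fun _ => 1) fun _ => K) :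
    square K I ∈ CMMSA.noSet (fun _ => g ^ 2) (fun _ => 1) fun _ => K * K := by
  obtain ⟨hwf, hdeg, hno⟩ := hI
  refine ⟨wellFormed_square K hwf, degree_square_le hdeg, fun B hB => ?_⟩
  rw [real_satCount_lt_iff]
  set n := I.numVars with hn
  set Φn := nontriv I.formulas with hΦn
  -- rows on which everything holds are expensive
  have hrow : ∀ i, (∀ φ ∈ Φn, φ.eval (row n B i) = true) → g * I.threshold < I.weightOf (row n B i) := by
    intro i hi
    by_contra hle
    push Not at hle
    obtain ⟨φ, hφ, hfalse⟩ := (real_satCount_lt_iff I _).1 (hno _ hle)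
    have := hi φ (mem_nontriv_of_eval_eq_false hφ hfalse)
    rw [this] at hfalse
    exact Bool.noConfusion hfalse
  -- the set `Y` of such rows, as an assignment of the original instance
  set y : ℕ → Bool := fun i => decide (∀ φ ∈ Φn, φ.eval (row n B i) = true) with hy
  have hy_true : ∀ i, y i = true → ∀ φ ∈ Φn, φ.eval (row n B i) = true := fun i hi => by
    simpa [hy] using hi
  -- `w(Y) ≤ g s`
  have hsum := weightOf_square_eq_sum_rows (K := K) hwf.1 B
  have hB' : ((square K I).weightOf B : ℝ) ≤ g ^ 2 * (I.threshold * I.threshold : ℕ) := by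
    simpa using hB
  have hyw : (I.weightOf y : ℝ) ≤ g * I.threshold := by
    by_contra hlt
    push Not at hlt
    have hg0 : 0 < g := one_pos.trans_le hg
    -- `w(Y)` as a filtered sum
    have hwy : I.weightOf y = ∑ i ∈ (Finset.range n).filter (fun i => y i = true), I.w i := by
      unfold CMMSAInstance.weightOf
      rw [Finset.sum_filter]
    -- the lower bound `Σ_{i ∈ Y} w i · w(row i) ≤ w'(B)`
    have hlow : (∑ i ∈ (Finset.range n).filter (fun i => y i = true), (I.w i : ℝ) * I.weightOf (row n B i))
        ≤ (square K I).weightOf B := by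
      rw [hsum]
      push_cast
      exact Finset.sum_le_sum_of_subset_of_nonneg (Finset.filter_subset _ _) fun i _ _ => by positivity
    by_cases hgs : 0 < g * I.threshold
    · -- `g s · w(Y) < Σ_{i∈Y} w i · w(row i)` is impossible … unless `w(Y) ≤ g s`
      have h1 : g * I.threshold * I.weightOf y ≤
          ∑ i ∈ (Finset.range n).filter (fun i => y i = true), (I.w i : ℝ) * I.weightOf (row n B i) := by
        rw [hwy]
        push_cast
        rw [Finset.mul_sum]
        refine Finset.sum_le_sum fun i hi => ?_
        rw [mul_comm]
        exact mul_le_mul_of_nonneg_left (hrow i (hy_true i (Finset.mem_filter.1 hi).2)).le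
          (Nat.cast_nonneg _)
      have h2 : g * I.threshold * (g * I.threshold) < g * I.threshold * I.weightOf y :=
        mul_lt_mul_of_pos_left hlt hgs
      have h3 : ((square K I).weightOf B : ℝ) ≤ g * I.threshold * (g * I.threshold) := by
        refine hB'.trans (le_of_eq ?_)
        push_cast
        ring
      linarith
    · -- `g s = 0`: then `s = 0`, and a row of positive weight in `Y` makes `w'(B) > 0`
      have hs0 : (I.threshold : ℝ) = 0 := by
        by_contra hs
        have : (0 : ℝ) < I.threshold := lt_of_le_of_ne (Nat.cast_nonneg _) (Ne.symm hs)
        exact hgs (mul_pos hg0 this)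
      rw [hs0, mul_zero] at hlt
      have hlt' : 0 < I.weightOf y := by exact_mod_cast hlt
      rw [hwy] at hlt'
      obtain ⟨i, hi, hwi⟩ := Finset.exists_ne_zero_of_sum_ne_zero hlt'.ne'
      replace hwi : 1 ≤ I.w i := Nat.pos_of_ne_zero hwi
      have hri : g * I.threshold < I.weightOf (row n B i) := hrow i (hy_true i (Finset.mem_filter.1 hi).2)
      rw [hs0, mul_zero] at hri
      have hri' : 1 ≤ I.weightOf (row n B i) := by exact_mod_cast hri
      have hterm : (1 : ℝ) ≤ (I.w i : ℝ) * I.weightOf (row n B i) := by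
        have h1 : (1 : ℝ) ≤ I.w i := by exact_mod_cast hwi
        have h2 : (1 : ℝ) ≤ I.weightOf (row n B i) := by exact_mod_cast hri'
        nlinarith
      have hle1 : (I.w i : ℝ) * I.weightOf (row n B i) ≤
          ∑ i ∈ (Finset.range n).filter (fun i => y i = true), (I.w i : ℝ) * I.weightOf (row n B i) :=
        Finset.single_le_sum (f := fun i => (I.w i : ℝ) * I.weightOf (row n B i))
          (fun j _ => by positivity) hi
      have h3 : ((square K I).weightOf B : ℝ) ≤ 0 := by
        refine hB'.trans (le_of_eq ?_)
        push_cast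
        rw [hs0]
        ring
      linarith
  -- the no-promise falsifies some (non-trivial) `φ` on `Y`
  obtain ⟨φ, hφ, hφy⟩ := (real_satCount_lt_iff I y).1 (hno y hyw)
  have hφn : φ ∈ Φn := mem_nontriv_of_eval_eq_false hφ hφy
  -- choose, per term, a variable outside `Y` and a formula false on its row
  have hterms : ∀ l ∈ choices Φn φ, ∃ q ∈ l, q.2.eval (row n B q.1) = false := by
    intro l hl
    unfold choices at hl
    obtain ⟨t, ht, rfl⟩ := List.mem_map.1 hl
    obtain ⟨i, hit, hiy⟩ := (eval_eq_false_iff φ y).1 hφy t ht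
    have : ¬ ∀ φ' ∈ Φn, φ'.eval (row n B i) = true := by
      intro h
      have : y i = true := by simpa [hy] using h
      rw [this] at hiy
      exact Bool.noConfusion hiy
    push Not at this
    obtain ⟨φ', hφ', hφ'f⟩ := this
    exact ⟨(i, φ'), List.mem_product.2 ⟨hit, hφ'⟩, by simpa using hφ'f⟩
  obtain ⟨c, hcF, hcq⟩ := exists_forall₂_of_forall_exists _ hterms
  have hc : c ∈ sectionsK K (choices Φn φ) := by
    rw [hΦn, sectionsK_choices_eq hdeg (hΦn ▸ hφn), List.mem_sections]
    exact hΦn ▸ hcF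
  refine ⟨secFormula n c, ?_, ?_⟩
  · rw [square_formulas, mem_sqFormulas]
    exact ⟨φ, hΦn ▸ hφn, c, hΦn ▸ hc, rfl⟩
  · rw [← Bool.not_eq_true, eval_secFormula_eq_true_iff]
    rintro ⟨q, hq, hqB⟩
    rw [hcq q hq] at hqB
    exact Bool.noConfusion hqB

end CMMSASquare

end Literature.Computability.Complexity
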